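import Summits.BirchSwinnertonDyer.BirchSwinnertonDyer.Theses.ShaPrimaryTransfer
import Summits.BirchSwinnertonDyer.BirchSwinnertonDyer.Theorems.SelmerRankShaCorank
import Literature.NumberTheory.EllipticCurves.BSDLowerBoundLayersProofs
import Literature.NumberTheory.EllipticCurves.BSDSelmerPConverseRankZeroOrdinaryProofs
import Literature.NumberTheory.EllipticCurves.CMTorsionIrreducibleOrdinaryProofs
import Literature.NumberTheory.EllipticCurves.BSDpVariableChangeProofs

/-!
# BirchSwinnertonDyer / ShaPrimaryTransfer — crux `FiniteShaComponentTransfer` (stmt-BirchSwinnertonDyer-22356):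
# the transfer in ALGEBRAIC rank ≤ 1 through the `p`-converse theorems, and where the door prime sits

Companion to `ShaPrimaryTransferFiniteShaComponentTransferSlices` (analytic coordinates: T holds below
`ord_{s=1} L(E,s) = 2` by Gross–Zagier–Kolyvagin, and is open from 2 on). Here the same transfer
`t_p(E) = 0 ⟹ t_q(E) = 0` (`t_p(E) = corank_{ℤ_p} Ш(E)[p^∞] = W.shaCorank p`) is read in the coordinates the
route's DOOR actually produces — a prime `p` at which descent certified `t_p(E) = 0`, together with the
Mordell–Weil rank — and pushed through the printed `p`-CONVERSE theorems: `t_p(E) = 0` makes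
`corank Sel_{p^∞}(E/ℚ) = rank E(ℚ)` (Greenberg's identity, tree theorem
`selmerCorank_eq_mordellWeilRank_add_holds`), a `p`-converse at `p` turns that into `ord_{s=1} L(E,s) = rank ≤ 1`,
and Gross–Zagier–Kolyvagin makes `Ш(E/ℚ)` finite, so every `t_q(E)` vanishes. Every theorem is proved over
the tree with the deep inputs as explicit named-fact HYPOTHESES (all in print, none discharged in the tree):

* `transfer_of_hasCM_of_mordellWeilRank_eq_zero` — CM curves of rank `0`, door at ANY prime `p` (so `p = 2`
  and `p = 3` INCLUDED): Burungale–Tian 2026 Thm. 1.1 (`hBT0`, rank-zero `p`-converse for CM curves at every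
  prime) + GZK (`hGZK`). This is the one sector where the route's «door at 2» transfers in print.
* `transfer_of_mordellWeilRank_eq_zero_of_goodOrdinary` — rank `0`, door at a good ordinary `p ≥ 5` with
  `E[p]` irreducible (global minimal model): cyclotomic main conjecture (`hMC`, Burungale–Castella–Skinner
  2025 Thm. 1.1.2) + modularity (`hmod`) + GZK, via the tree theorem
  `analyticRank_eq_zero_of_selmerCorank_eq_zero_of_mazurMainConjecture`.
* `transfer_of_mordellWeilRank_eq_one_of_goodOrdinary` — rank `1`, door at a good ordinary `p > 3` with
  `E[p]` irreducible unless CM: Kim 2022 Cor. 1.4 (`hKim`) / Burungale–Tian 2020 Thm. 1.2 (`hBT1`) + GZK, via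
  `analyticRank_eq_one_of_mordellWeilRank_eq_one_of_finite_sha_primary`.
* `transfer_of_mordellWeilRank_le_one_of_goodOrdinary` — the two together at a good ordinary `p ≥ 5`
  (`E[p]` irreducible unless CM; for CM curves irreducibility at such `p` is the tree theorem
  `hasIrreducibleModPGaloisRep_of_hasCM_of_five_le`).

* `shaCorank_eq_zero_smul_iff`, `finiteShaComponentTransfer_iff_minimal` — `t_p(E) = 0` is an isomorphism
  invariant (tree theorem `finite_primaryComponent_sha_variableChange_iff`), so T may be checked on global
  minimal models (`hasGlobalMinimalModel_rat_holds`), where reduction types and `a_p` are read.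
* `finiteShaComponentTransfer_iff_offSector_of_facts` — THE EXACT OPEN RESIDUE in door coordinates: granting the
  six printed theorems above (`hBT0`, `hmod`, `hMC`, `hKim`, `hBT1`, `hGZK`), T is EQUIVALENT to its restriction
  to the complement of the `p`-converse sector {CM ∧ rank `0`} ∪ {`p ≥ 5` good ordinary, `E[p]` irreducible
  unless CM, rank `≤ 1`} (on global minimal models).

WHAT IS LEFT OPEN, in these coordinates (numbers, not adjectives): (i) `rank E(ℚ) ≥ 2` at every door prime —
no `p`-converse of rank ≥ 2 exists; (ii) rank `≤ 1` with the door at `p ∈ {2, 3}`, at a bad or supersingular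
prime, or at an Eisenstein prime of a non-CM curve — in particular the route's cheapest door, complete
2-descent on a NON-CM curve of rank `0` (`Sel_{2^∞}(E/ℚ)` finite ⟹ `L(E,1) ≠ 0`?), is the rank-zero
2-CONVERSE for non-CM curves, not in print. Nothing here proves T, O or BSD.

References: A. Burungale, Y. Tian, Ann. of Math. 203 (2026), Thm. 1.1; A. Burungale, F. Castella, C. Skinner,
IMRN (2025), Thm. 1.1.2; C.-H. Kim, Math. Ann. 387 (2022), Cor. 1.4; A. Burungale, Y. Tian, Invent. Math. 220
(2020), Thm. 1.2; R. Greenberg, LNM 1716 (1999), §1 and Thm. 4.1; V. Kolyvagin, Grothendieck Festschrift II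
(1990), Thm. A; B. Gross, D. Zagier, Invent. Math. 84 (1986).
-/

-- D-0017: single-problem summit, so `Summit.BirchSwinnertonDyer.BirchSwinnertonDyer.…` repeats a namespace BY DESIGN.
set_option linter.dupNamespace false

noncomputable section

namespace Summit.BirchSwinnertonDyer.BirchSwinnertonDyer.Theorems.ShaPrimaryTransferSectors

open scoped Classical
open Literature.NumberTheory.EllipticCurves Literature.NumberTheory.EllipticCurves.ModularForms
open WeierstrassCurve

/-! ## Bookkeeping: the door datum `t_p(E) = 0` in Selmer coordinates -/

/-- At a prime where `corank_{ℤ_p} Ш(E)[p^∞] = 0`, the `p^∞`-Selmer corank IS the Mordell–Weil rank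
(Greenberg's identity `corank Sel_{p^∞} = rank + corank Ш[p^∞]`, LNM 1716 §1, tree theorem
`selmerCorank_eq_mordellWeilRank_add_holds`). [cite: Greenberg1999LNM, §1 pp. 54–57] -/
theorem selmerCorank_eq_mordellWeilRank_of_shaCorank_eq_zero (W : WeierstrassCurve ℚ) [W.IsElliptic]
    (p : ℕ) [Fact p.Prime] (h0 : W.shaCorank p = 0) : W.selmerCorank p = W.mordellWeilRank := by
  rw [W.selmerCorank_eq_mordellWeilRank_add_holds p, h0, add_zero]

/-! ## CM curves of rank 0: the door at ANY prime transfers (Burungale–Tian 2026) -/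

/-- **Transfer for CM curves of rank `0`, door at any prime.** For a CM elliptic `E/ℚ` with
`rank E(ℚ) = 0` and `corank_{ℤ_p} Ш(E)[p^∞] = 0` at SOME prime `p` — any prime, `p = 2, 3` allowed — every
`corank_{ℤ_q} Ш(E)[q^∞]` vanishes: `corank Sel_{p^∞} = 0`, so `ord_{s=1} L(E,s) = 0` by Burungale–Tian's
rank-zero `p`-converse for CM curves at every prime (`hBT0`, Ann. of Math. 203 (2026) Thm. 1.1), so `Ш(E/ℚ)`
is finite by Gross–Zagier–Kolyvagin / Rubin (`hGZK`). CONDITIONAL on the named facts `hBT0`, `hGZK`.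
[cite: BurungaleTian2026, Thm. 1.1] [cite: Kolyvagin1990, Thm. A] -/
theorem transfer_of_hasCM_of_mordellWeilRank_eq_zero
    (hBT0 : burungaleTian_analyticRank_eq_zero_of_selmerCorank_eq_zero_of_hasCM)
    (hGZK : rank_eq_analyticRank_of_analyticRank_le_one)
    (W : WeierstrassCurve ℚ) [W.IsElliptic] (hCM : W.HasCM) (p q : ℕ) [Fact p.Prime] [Fact q.Prime]
    (hr : W.mordellWeilRank = 0) (h0 : W.shaCorank p = 0) : W.shaCorank q = 0 := by
  have hs : W.selmerCorank p = 0 := by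
    rw [selmerCorank_eq_mordellWeilRank_of_shaCorank_eq_zero W p h0, hr]
  have ha : W.analyticRank = 0 := hBT0 W hCM p hs
  haveI : Finite ↥W.sha := (hGZK W (by omega)).2
  exact Literature.BSD.shaCorank_eq_zero_of_finite W q
    (inferInstance : Finite ↥(AddCommGroup.primaryComponent W.sha q))

/-! ## Rank 0, door at a good ordinary `p ≥ 5` with `E[p]` irreducible (main conjecture) -/

/-- **Transfer in rank `0` from a good ordinary door prime.** For an elliptic `E/ℚ` on a global minimal
model with `rank E(ℚ) = 0`, a prime `p ≥ 5` of good ordinary reduction with `E[p]` irreducible and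
`corank_{ℤ_p} Ш(E)[p^∞] = 0`, every `corank_{ℤ_q} Ш(E)[q^∞]` vanishes: `Sel_{p^∞}(E/ℚ)` is cotorsion, so
`L(E,1) ≠ 0` by the cyclotomic main conjecture with Greenberg's Thm. 4.1 and interpolation (tree theorem
`analyticRank_eq_zero_of_selmerCorank_eq_zero_of_mazurMainConjecture`, facts `hmod` = modularity,
`hMC` = Burungale–Castella–Skinner 2025 Thm. 1.1.2), then `Ш(E/ℚ)` is finite by Kolyvagin (`hGZK`).
CONDITIONAL on `hmod`, `hMC`, `hGZK`. [cite: BurungaleCastellaSkinner2025, Thm. 1.1.2 (a)]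
[cite: GreenbergLNM1716, Thm. 4.1] [cite: Kolyvagin1990, Thm. A] -/
theorem transfer_of_mordellWeilRank_eq_zero_of_goodOrdinary
    (hmod : exists_isNewformOf) (hMC : burungale_castella_skinner_charIdeal_eq_padicLFunction)
    (hGZK : rank_eq_analyticRank_of_analyticRank_le_one)
    (W : WeierstrassCurve ℚ) [W.IsElliptic] [W.IsGloballyMinimal] (p q : ℕ) [Fact p.Prime] [Fact q.Prime]
    (hp : 5 ≤ p) (hgood : W.HasGoodReductionAtPrime p) (hord : ¬ (p : ℤ) ∣ W.frobeniusTrace p)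
    (hirr : W.HasIrreducibleModPGaloisRep p) (hr : W.mordellWeilRank = 0) (h0 : W.shaCorank p = 0) :
    W.shaCorank q = 0 := by
  have hs : W.selmerCorank p = 0 := by
    rw [selmerCorank_eq_mordellWeilRank_of_shaCorank_eq_zero W p h0, hr]
  have ha : W.analyticRank = 0 :=
    analyticRank_eq_zero_of_selmerCorank_eq_zero_of_mazurMainConjecture hmod hMC W p hp hgood hord hirr hs
  haveI : Finite ↥W.sha := (hGZK W (by omega)).2
  exact Literature.BSD.shaCorank_eq_zero_of_finite W q
    (inferInstance : Finite ↥(AddCommGroup.primaryComponent W.sha q))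

/-! ## Rank 1, door at a good ordinary `p > 3` (Kim; Burungale–Tian) -/

/-- **Transfer in rank `1` from a good ordinary door prime.** For an elliptic `E/ℚ` on a global minimal
model with `rank E(ℚ) = 1`, a prime `p > 3` of good ordinary reduction with `E[p]` irreducible when `E` has
no CM, and `corank_{ℤ_p} Ш(E)[p^∞] = 0` (i.e. `Ш(E)[p^∞]` finite): `ord_{s=1} L(E,s) = 1` by the rank-one
`p`-converse (Kim 2022 Cor. 1.4, `hKim`, non-CM; Burungale–Tian 2020 Thm. 1.2, `hBT1`, CM; tree theorem
`analyticRank_eq_one_of_mordellWeilRank_eq_one_of_finite_sha_primary`), so `Ш(E/ℚ)` is finite by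
Gross–Zagier–Kolyvagin (`hGZK`) and every `corank_{ℤ_q} Ш(E)[q^∞]` vanishes.
CONDITIONAL on `hKim`, `hBT1`, `hGZK`. [cite: Kim2022, Cor. 1.4] [cite: BurungaleTian2019, Thm. 1.2]
[cite: Kolyvagin1990, Thm. A] -/
theorem transfer_of_mordellWeilRank_eq_one_of_goodOrdinary
    (hKim : kim_analyticRank_eq_one_of_mordellWeilRank_eq_one)
    (hBT1 : burungaleTian_analyticRank_eq_one_of_selmerCorank_eq_one_of_hasCM)
    (hGZK : rank_eq_analyticRank_of_analyticRank_le_one)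
    (W : WeierstrassCurve ℚ) [W.IsElliptic] [W.IsGloballyMinimal] (p q : ℕ) [Fact p.Prime] [Fact q.Prime]
    (hp : 3 < p) (hgood : W.HasGoodReductionAtPrime p) (hord : ¬ (p : ℤ) ∣ W.frobeniusTrace p)
    (hirr : ¬ W.HasCM → W.HasIrreducibleModPGaloisRep p) (hr : W.mordellWeilRank = 1)
    (h0 : W.shaCorank p = 0) : W.shaCorank q = 0 := by
  have hfin : Finite ↥(AddCommGroup.primaryComponent W.sha p) :=
    (finite_primaryComponent_sha_iff_shaCorank_eq_zero W p).2 h0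
  have ha : W.analyticRank = 1 :=
    analyticRank_eq_one_of_mordellWeilRank_eq_one_of_finite_sha_primary hKim hBT1 W p hp hgood hord hirr
      hr hfin
  haveI : Finite ↥W.sha := (hGZK W (by omega)).2
  exact Literature.BSD.shaCorank_eq_zero_of_finite W q
    (inferInstance : Finite ↥(AddCommGroup.primaryComponent W.sha q))

/-! ## Rank ≤ 1 together, door at a good ordinary `p ≥ 5` -/

/-- **Transfer in algebraic rank `≤ 1` from a good ordinary door prime `p ≥ 5`** (`E[p]` irreducible unless
`E` has CM; a CM curve has `E[p]` irreducible at every good ordinary `p ≥ 5`, tree theorem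
`hasIrreducibleModPGaloisRep_of_hasCM_of_five_le`): the two previous theorems. In these coordinates the
crux `FiniteShaComponentTransfer` is OPEN exactly off this sector: rank `≥ 2`, or a door prime that is
`2`, `3`, bad, supersingular, or Eisenstein for a non-CM curve. CONDITIONAL on `hmod`, `hMC`, `hKim`,
`hBT1`, `hGZK`. [cite: BurungaleCastellaSkinner2025, Thm. 1.1.2 (a)] [cite: Kim2022, Cor. 1.4]
[cite: BurungaleTian2019, Thm. 1.2] [cite: Kolyvagin1990, Thm. A] -/
theorem transfer_of_mordellWeilRank_le_one_of_goodOrdinary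
    (hmod : exists_isNewformOf) (hMC : burungale_castella_skinner_charIdeal_eq_padicLFunction)
    (hKim : kim_analyticRank_eq_one_of_mordellWeilRank_eq_one)
    (hBT1 : burungaleTian_analyticRank_eq_one_of_selmerCorank_eq_one_of_hasCM)
    (hGZK : rank_eq_analyticRank_of_analyticRank_le_one)
    (W : WeierstrassCurve ℚ) [W.IsElliptic] [W.IsGloballyMinimal] (p q : ℕ) [Fact p.Prime] [Fact q.Prime]
    (hp : 5 ≤ p) (hgood : W.HasGoodReductionAtPrime p) (hord : ¬ (p : ℤ) ∣ W.frobeniusTrace p)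
    (hirr : ¬ W.HasCM → W.HasIrreducibleModPGaloisRep p) (hr : W.mordellWeilRank ≤ 1)
    (h0 : W.shaCorank p = 0) : W.shaCorank q = 0 := by
  rcases Nat.le_one_iff_eq_zero_or_eq_one.1 hr with hr0 | hr1
  · have hirr' : W.HasIrreducibleModPGaloisRep p := by
      by_cases hCM : W.HasCM
      · exact hasIrreducibleModPGaloisRep_of_hasCM_of_five_le W hCM p hp hgood hord
      · exact hirr hCM
    exact transfer_of_mordellWeilRank_eq_zero_of_goodOrdinary hmod hMC hGZK W p q hp hgood hord hirr' hr0 h0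
  · exact transfer_of_mordellWeilRank_eq_one_of_goodOrdinary hKim hBT1 hGZK W p q (by omega) hgood hord hirr
      hr1 h0

/-! ## Reduction to global minimal models -/

/-- `corank_{ℤ_p} Ш(E)[p^∞] = 0` is an isomorphism invariant: for a change of variables `C`,
`t_p(C • W) = 0 ↔ t_p(W) = 0` (`Ш(C • W)[p^∞]` finite iff `Ш(W)[p^∞]` finite, tree theorem
`finite_primaryComponent_sha_variableChange_iff`, and `t_p = 0 ↔` finite). [cite: SilvermanAEC2009, X.§4 Rem. 4.1.1] -/
theorem shaCorank_eq_zero_smul_iff (W : WeierstrassCurve ℚ) [W.IsElliptic] (C : VariableChange ℚ) (p : ℕ)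
    [Fact p.Prime] : (C • W).shaCorank p = 0 ↔ W.shaCorank p = 0 := by
  rw [← finite_primaryComponent_sha_iff_shaCorank_eq_zero (C • W) p,
    ← finite_primaryComponent_sha_iff_shaCorank_eq_zero W p]
  exact finite_primaryComponent_sha_variableChange_iff W C p

/-- **T may be checked on global minimal models** (every elliptic `W/ℚ` has one, Néron / *AEC* VIII.8.3,
tree theorem `hasGlobalMinimalModel_rat_holds`; `t_p = 0` is carried by the isomorphism,
`shaCorank_eq_zero_smul_iff`). [cite: SilvermanAEC2009, Cor. VIII.8.3] -/
theorem finiteShaComponentTransfer_iff_minimal :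
    Summit.BirchSwinnertonDyer.BirchSwinnertonDyer.Theses.ShaPrimaryTransfer.FiniteShaComponentTransfer ↔
      ∀ (W : WeierstrassCurve ℚ) [W.IsElliptic] [W.IsGloballyMinimal] (p q : ℕ) [Fact p.Prime]
        [Fact q.Prime], W.shaCorank p = 0 → W.shaCorank q = 0 := by
  constructor
  · intro h W _ _ p q _ _ hp
    exact h W p q hp
  · intro h W _ p q _ _ hp
    obtain ⟨C, hC⟩ := hasGlobalMinimalModel_rat_holds W
    have hp' : (C • W).shaCorank p = 0 := (shaCorank_eq_zero_smul_iff W C p).2 hp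
    exact (shaCorank_eq_zero_smul_iff W C q).1 (h (C • W) p q hp')

/-! ## The exact open residue in door coordinates -/

/-- **The open residue of T in the door's coordinates.** Granting the six printed theorems — Burungale–Tian
2026 Thm. 1.1 (`hBT0`), modularity (`hmod`), the cyclotomic main conjecture (`hMC`, Burungale–Castella–Skinner
2025), Kim 2022 Cor. 1.4 (`hKim`), Burungale–Tian 2020 Thm. 1.2 (`hBT1`), Gross–Zagier–Kolyvagin (`hGZK`) — the
crux `FiniteShaComponentTransfer` is EQUIVALENT to its restriction, on global minimal models, to door data
`(E, p)` OUTSIDE the `p`-converse sector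
`(E CM ∧ rank E(ℚ) = 0) ∨ (p ≥ 5 good ordinary ∧ (E non-CM → E[p] irreducible) ∧ rank E(ℚ) ≤ 1)`.
So what remains is: rank `≥ 2` at any door prime; rank `≤ 1` non-CM with the door at `2`, `3`, a bad, a
supersingular or an Eisenstein prime; rank `1` CM with the door off the good ordinary primes `≥ 5`.
CONDITIONAL on the six named facts (only the direction residue ⟹ T uses them).
[cite: BurungaleTian2026, Thm. 1.1] [cite: BurungaleCastellaSkinner2025, Thm. 1.1.2 (a)] [cite: Kim2022, Cor. 1.4]
[cite: BurungaleTian2019, Thm. 1.2] [cite: Kolyvagin1990, Thm. A] -/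
theorem finiteShaComponentTransfer_iff_offSector_of_facts
    (hBT0 : burungaleTian_analyticRank_eq_zero_of_selmerCorank_eq_zero_of_hasCM)
    (hmod : exists_isNewformOf) (hMC : burungale_castella_skinner_charIdeal_eq_padicLFunction)
    (hKim : kim_analyticRank_eq_one_of_mordellWeilRank_eq_one)
    (hBT1 : burungaleTian_analyticRank_eq_one_of_selmerCorank_eq_one_of_hasCM)
    (hGZK : rank_eq_analyticRank_of_analyticRank_le_one) :
    Summit.BirchSwinnertonDyer.BirchSwinnertonDyer.Theses.ShaPrimaryTransfer.FiniteShaComponentTransfer ↔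
      ∀ (W : WeierstrassCurve ℚ) [W.IsElliptic] [W.IsGloballyMinimal] (p q : ℕ) [Fact p.Prime]
        [Fact q.Prime],
        ¬ ((W.HasCM ∧ W.mordellWeilRank = 0) ∨
            (5 ≤ p ∧ W.HasGoodReductionAtPrime p ∧ ¬ (p : ℤ) ∣ W.frobeniusTrace p ∧
              (¬ W.HasCM → W.HasIrreducibleModPGaloisRep p) ∧ W.mordellWeilRank ≤ 1)) →
        W.shaCorank p = 0 → W.shaCorank q = 0 := by
  rw [finiteShaComponentTransfer_iff_minimal]
  constructor
  · intro h W _ _ p q _ _ _ hp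
    exact h W p q hp
  · intro h W _ _ p q _ _ hp
    by_cases hsec : (W.HasCM ∧ W.mordellWeilRank = 0) ∨
        (5 ≤ p ∧ W.HasGoodReductionAtPrime p ∧ ¬ (p : ℤ) ∣ W.frobeniusTrace p ∧
          (¬ W.HasCM → W.HasIrreducibleModPGaloisRep p) ∧ W.mordellWeilRank ≤ 1)
    · rcases hsec with ⟨hCM, hr0⟩ | ⟨h5, hgood, hord, hirr, hr⟩
      · exact transfer_of_hasCM_of_mordellWeilRank_eq_zero hBT0 hGZK W hCM p q hr0 hp
      · exact transfer_of_mordellWeilRank_le_one_of_goodOrdinary hmod hMC hKim hBT1 hGZK W p q h5 hgood hord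
          hirr hr hp
    · exact h W p q hsec hp

end Summit.BirchSwinnertonDyer.BirchSwinnertonDyer.Theorems.ShaPrimaryTransferSectors
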